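/-
Origin: expansion seat `planner-pub-hodgecm-pv10-g4-0`, handover #8 2026-08-18T12:07:56Z (`HOME/pub-hodgecm-pv10-g4/lean/Pv10g4/SmallLevelTorsionFree.lean`, md5 366b08b4, 615 lines);
landed by the gen-8 packager in gate run 29 as `HodgeCM/PerL34/SmallLevelTorsionFree.lean` (import ^import Pv10g4\.LevelLattice[ \t]*$→import HodgeCM.PerL34.LevelLattice ×1; stripped 9 #print/#check/#eval lines).
-/
/-
Origin: HOME/pub-hodgecm-pv10-g4/lean/Pv10g4/SmallLevelTorsionFree.lean (WIP module `Pv10g4.SmallLevelTorsionFree`;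
intended final place `HodgeCM/PerL34/SmallLevelTorsionFree.lean` = module `HodgeCM.PerL34.SmallLevelTorsionFree`)
(import rewrite on landing: `import Pv10g4.LevelLattice` ↦ `import HodgeCM.PerL34.LevelLattice`).
-/
import Summits.HodgeConjecture.HodgeCM.PerL34.LevelLattice_2

/-!
# Small congruence levels give torsion-free lattices (PerL v5 ll. 72–75, KERNEL, group level)

PerL v5 §1.2, ll. 72–75: "For neat `K_f` these [the `Γ_j\\𝔹²` of `S(K_f) = ⨆_j Γ_j\\𝔹²`] are smooth projective
surfaces … in general there is a neat normal `K_1 ⊂ K_f` of finite index and `P_{K_f}` is the quotient of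
`P_{K_1}` by the finite group `K_f/K_1`."  This file proves the GROUP-LEVEL content, with "neat" replaced by the
standard explicit sufficient condition `K_f ⊆ K_H(n)`, `n ≥ 3` (Minkowski–Serre):

* §1 `eq_one_of_pow_prime_eq_one_of_entryLE` — the LOCAL LEMMA (pure valuation theory, any field `F` with a
  valuation `v`): if `v(k) ≤ 1` for `k ∈ ℕ`, `p` is a prime with `v(p) ≠ 0`, and `q ∈ F` has `v(q) < 1` and
  `v(q)^(p-1) < v(p)`, then a square matrix `κ` over `F` with `v(κ − 1) ≤ v(q)` entrywise and `κ^p = 1` equals `1`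
  (binomial theorem for the commuting pair `(κ − 1, 1)`, read at an entry of `κ − 1` of maximal valuation `μ`:
  `v(p)·μ ≤ max (v(p)·μ², μ^p)`, impossible for `0 < μ ≤ v(q)`);
* §2–§3 the arithmetic input: for `n ≥ 3` a prime `ℓ ∣ n` with `ℓ` odd or `4 ∣ n` (`exists_prime_modulus`), a
  finite place `v ∣ ℓ` of `L` (`exists_heightOneSpectrum_over_prime`: going-up for `ℤ → 𝓞_L`), the valuations
  `|k|_v` of rational integers in `L_v` (`valued_natCast`, `…_le_one`, `…_lt_one_iff`, `…_eq_one_iff`), and the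
  resulting place/modulus pair (`exists_place_modulus`: `q₀ ∣ n`, `|q₀|_v < 1`, `|q₀|_v^(p-1) < |p|_v` for EVERY
  prime `p`; `q₀ = ℓ`, or `q₀ = 4` when `ℓ = 2`);
* §4 evaluation at a place, `evalPlace L v : 𝔸_{L,f} →+* L_v` and `evalPlaceGL L v : GL_m(𝔸_{L,f}) →* GL_m(L_v)`
  (`GL_m(L) → GL_m(L_v)` injective), the entry bound `valued_sub_one_le_of_mem_finLevel` (`k ∈ K(n)` ⇒
  `|(k − 1)_{ij}|_v ≤ |n|_v`, row #6's `finLevel L m n = K(n)`), and **`eq_one_of_pow_prime_eq_one_of_conj_mem_finLevel`**: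
  `g₀ ∈ GL_m(L)`, `g₀^p = 1` (`p` prime), `g⁻¹ g₀ g ∈ K(n)` for some `g ∈ GL_m(𝔸_{L,f})`, `n ≥ 3` ⇒ `g₀ = 1`;
* §5 **`torsionFree_congruenceLattice_conj`**: for `n ≥ 3`, `K_f ≤ K_H(n) = levelUfin L H n` and EVERY
  `g ∈ U(H)(𝔸_{L₀,f})`: `∀ γ ∈ Γ_H(g K_f g⁻¹), IsOfFinOrder γ → γ = 1` — the shape of `HodgeCM.Level.torsionFree`;
  here `Γ_H(g K_f g⁻¹) = congruenceLattice L H (MulAut.conj g • Kf)` (row #4) are exactly the lattices `Γ_j` of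
  row #7's decomposition `shimuraSetEquiv`; special cases `torsionFree_congruenceLattice` (`g = 1`) and
  `torsionFree_congruenceLattice_levelUfin` (`K_f = K_H(n)`); with row #5 (`stabilizer_inf_eq_bot_of_torsionFree`):
  **`stabilizer_congruenceLattice_conj_eq_bot`** — for compact `K_f ⊆ K_H(n)`, every `Γ_j` acts FREELY on
  `U(H)_∞ / C` for every compact subgroup `C` (e.g. `C = K_∞`);
* §6 the `HermSpace3` specialisations `HodgeCM.HermSpace3.torsionFree_congruenceLattice_conj`,
  `HodgeCM.HermSpace3.stabilizer_congruenceLattice_conj_eq_bot`;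
* §7 **`exists_normal_finiteIndex_le_levelUfin`** (ll. 74–75): every compact open `K_f` contains a compact open
  `K₁ ≤ K_f ∩ K_H(n)` which is normal and of finite index in `K_f` (the normal core of `K_f ∩ K_H(n)` in the
  compact group `K_f`).

Relation to the tree: `HodgeCM/Model/ToyG2/LevelExists.lean` (`principalCongruenceSubgroup_three_torsionFree`)
proves torsion-freeness of the RATIONAL principal congruence subgroup `Γ(3) ≤ U(H)(L)` by a global argument over
`𝓞_L` at level `3`; through row #6's `congruenceLattice_levelUfin` that is the case `g = 1`, `K_f = K_H(3)` of §5.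
New here: all conjugates `g` (the `Γ_H(g K_f g⁻¹)`, `g ∈ U(H)(𝔸_{L₀,f})`, are not principal congruence subgroups of
the standard lattice — their elements need not have integral entries) and all `n ≥ 3` (for `n = 4, 8, …` the
prime is `ℓ = 2` with modulus `q₀ = 4`), by a LOCAL argument at a single place `v ∣ ℓ`.

Scope / honesty: group level only — no complex structure, no `≃ₜ 𝔹²`, no smoothness or projectivity of any
variety, no quotient map `P_{K_1} → P_{K_f}`; "neat" itself (eigenvalues generating a torsion-free subgroup of
`ℚ̄ˣ`) is not defined — `K_f ⊆ K_H(n)`, `n ≥ 3`, is the standard sufficient condition used instead.  KERNEL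
theorems only: complete proofs, nothing cited, nothing posited; axioms `propext`, `Classical.choice`, `Quot.sound`.
-/

set_option autoImplicit false

noncomputable section

open scoped Pointwise MatrixGroups RestrictedProduct Matrix NumberField
open NumberField IsDedekindDomain Topology
open HodgeCM.Adelic HodgeCM.PerL34.AdelicUnitaryFactorisation

namespace HodgeCM.PerL34.Godement

/-! ## §1 Minkowski–Serre: a local valuation lemma on matrices -/

section Valuation

variable {F Γ₀ : Type*} [Field F] [LinearOrderedCommGroupWithZero Γ₀] (v : Valuation F Γ₀) {ι : Type*}

/-- Every entry of `M` has valuation `≤ a`. -/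
def EntryLE (M : Matrix ι ι F) (a : Γ₀) : Prop := ∀ i j, v (M i j) ≤ a

variable {v}

/-- (Ported verbatim from the HodgeCMPerL package; no docstring in the source.) -/
theorem EntryLE.mul [Fintype ι] {M N : Matrix ι ι F} {a b : Γ₀} (hM : EntryLE v M a) (hN : EntryLE v N b) :
    EntryLE v (M * N) (a * b) := by
  intro i j
  rw [Matrix.mul_apply]
  refine v.map_sum_le fun k _ => ?_
  rw [map_mul]
  exact mul_le_mul' (hM i k) (hN k j)

variable (v) in
/-- (Ported verbatim from the HodgeCMPerL package; no docstring in the source.) -/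
theorem entryLE_one [DecidableEq ι] : EntryLE v (1 : Matrix ι ι F) 1 := by
  intro i j
  rw [Matrix.one_apply]
  split_ifs <;> simp

/-- (Ported verbatim from the HodgeCMPerL package; no docstring in the source.) -/
theorem EntryLE.pow [Fintype ι] [DecidableEq ι] {M : Matrix ι ι F} {a : Γ₀} (hM : EntryLE v M a) : ∀ k : ℕ, EntryLE v (M ^ k) (a ^ k)
  | 0 => by simpa only [pow_zero] using entryLE_one v
  | k + 1 => by
      rw [pow_succ, pow_succ]
      exact (EntryLE.pow hM k).mul hM

/-- (Ported verbatim from the HodgeCMPerL package; no docstring in the source.) -/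
theorem EntryLE.mono {M : Matrix ι ι F} {a b : Γ₀} (hM : EntryLE v M a) (hab : a ≤ b) : EntryLE v M b :=
  fun i j => (hM i j).trans hab

/-- **Minkowski–Serre, local form.**  Let `v` be a valuation on a field `F` with `v(k) ≤ 1` for all `k ∈ ℕ`,
`p` a prime with `v(p) ≠ 0`, and `q ∈ F` with `v(q) < 1` and `v(q)^(p-1) < v(p)`.  If `κ ∈ M_ι(F)` satisfies
`v(κ − 1) ≤ v(q)` entrywise and `κ^p = 1`, then `κ = 1`.  (Binomial expansion of `(1 + δ)^p = 1` at an entry of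
`δ = κ − 1` of maximal valuation `μ`: `v(p) μ ≤ max (v(p) μ², μ^p)`, impossible for `0 < μ ≤ v(q)`.) -/
theorem eq_one_of_pow_prime_eq_one_of_entryLE [Fintype ι] [DecidableEq ι] (hN : ∀ k : ℕ, v (k : F) ≤ 1) {p : ℕ} (hp : p.Prime)
    (hp0 : v (p : F) ≠ 0) {q : F} (hq1 : v q < 1) (hpq : v q ^ (p - 1) < v (p : F))
    {κ : Matrix ι ι F} (hκq : EntryLE v (κ - 1) (v q)) (hκp : κ ^ p = 1) : κ = 1 := by
  classical
  by_contra hne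
  set δ : Matrix ι ι F := κ - 1 with hδ
  have hκ : κ = δ + 1 := by rw [hδ, sub_add_cancel]
  -- an entry of `δ` of maximal valuation
  obtain ⟨i, j, hij⟩ : ∃ i j, δ i j ≠ 0 := by
    by_contra h
    push Not at h
    exact hne (sub_eq_zero.mp (Matrix.ext fun i j => h i j))
  obtain ⟨⟨i₀, j₀⟩, -, hmax⟩ := Finset.exists_max_image (Finset.univ : Finset (ι × ι))
    (fun ij => v (δ ij.1 ij.2)) ⟨(i, j), Finset.mem_univ _⟩
  set μ : Γ₀ := v (δ i₀ j₀) with hμ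
  have hle : EntryLE v δ μ := fun i' j' => hmax (i', j') (Finset.mem_univ _)
  have hμpos : 0 < μ := lt_of_lt_of_le (v.pos_iff.mpr hij) (hle i j)
  have hμq : μ ≤ v q := hκq i₀ j₀
  have hμ1 : μ < 1 := lt_of_le_of_lt hμq hq1
  -- write `p = r + 2`
  obtain ⟨r, rfl⟩ : ∃ r, p = r + 1 + 1 := ⟨p - 2, by have := hp.two_le; omega⟩
  -- binomial expansion of `(δ + 1) ^ p = 1`
  have hbin : ∑ k ∈ Finset.range (r + 1 + 1 + 1),
      δ ^ k * (((r + 1 + 1).choose k : ℕ) : Matrix ι ι F) = 1 := by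
    have h := (Commute.one_right δ).add_pow (r + 1 + 1)
    simp only [one_pow, mul_one] at h
    rw [← h, ← hκ, hκp]
  have hentry : ∀ k : ℕ, (δ ^ k * (((r + 1 + 1).choose k : ℕ) : Matrix ι ι F)) i₀ j₀ =
      (δ ^ k) i₀ j₀ * (((r + 1 + 1).choose k : ℕ) : F) := by
    intro k
    rw [← Matrix.diagonal_natCast, Matrix.mul_diagonal]
  have hsum := congrArg (fun M : Matrix ι ι F => M i₀ j₀) hbin
  simp only [Matrix.sum_apply, hentry] at hsum
  rw [Finset.sum_range_succ', Finset.sum_range_succ'] at hsum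
  simp only [zero_add, pow_zero, pow_one, Nat.choose_zero_right, Nat.choose_one_right, Nat.cast_one,
    mul_one] at hsum
  -- `hsum : S + δ i₀ j₀ * ↑(r+1+1) + (1 : Matrix) i₀ j₀ = (1 : Matrix) i₀ j₀`
  have hkey : δ i₀ j₀ * (((r + 1 + 1 : ℕ) : F)) =
      -∑ k ∈ Finset.range (r + 1), (δ ^ (k + 1 + 1)) i₀ j₀ * (((r + 1 + 1).choose (k + 1 + 1) : ℕ) : F) := by
    have := hsum
    push_cast at this ⊢
    linear_combination this
  -- valuation bound of every term of the sum
  set B : Γ₀ := max (v ((r + 1 + 1 : ℕ) : F) * μ ^ 2) (μ ^ (r + 1 + 1)) with hB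
  have hterm : ∀ k ∈ Finset.range (r + 1),
      v ((δ ^ (k + 1 + 1)) i₀ j₀ * (((r + 1 + 1).choose (k + 1 + 1) : ℕ) : F)) ≤ B := by
    intro k hk
    rw [Finset.mem_range] at hk
    rw [map_mul]
    have hpow : v ((δ ^ (k + 1 + 1)) i₀ j₀) ≤ μ ^ (k + 1 + 1) := hle.pow (k + 1 + 1) i₀ j₀
    rcases Nat.lt_or_ge (k + 1 + 1) (r + 1 + 1) with hlt | hge
    · -- `p ∣ C(p, k+2)`
      obtain ⟨t, ht⟩ := hp.dvd_choose_self (k := k + 1 + 1) (by omega) hlt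
      have hC : v ((((r + 1 + 1).choose (k + 1 + 1) : ℕ) : F)) ≤ v ((r + 1 + 1 : ℕ) : F) := by
        rw [ht, Nat.cast_mul, map_mul]
        exact mul_le_of_le_one_right' (hN t)
      refine le_trans ?_ (le_max_left _ _)
      rw [mul_comm]
      refine mul_le_mul' hC (hpow.trans ?_)
      exact pow_le_pow_right_of_le_one' hμ1.le (by omega)
    · have hkr : k = r := by omega
      subst hkr
      rw [Nat.choose_self, Nat.cast_one, map_one, mul_one]
      exact hpow.trans (le_max_right _ _)
  have hmain : v ((r + 1 + 1 : ℕ) : F) * μ ≤ B := by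
    have h1 : v (δ i₀ j₀ * ((r + 1 + 1 : ℕ) : F)) ≤ B := by
      rw [hkey, Valuation.map_neg]
      exact v.map_sum_le hterm
    rwa [map_mul, mul_comm] at h1
  -- contradiction
  have hp0' : 0 < v ((r + 1 + 1 : ℕ) : F) := zero_lt_iff.mpr hp0
  rcases le_max_iff.mp hmain with h | h
  · -- `v p * μ ≤ v p * μ ^ 2` ⇒ `1 ≤ μ`
    have h' : 1 * (v ((r + 1 + 1 : ℕ) : F) * μ) ≤ μ * (v ((r + 1 + 1 : ℕ) : F) * μ) := by
      rw [one_mul]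
      calc v ((r + 1 + 1 : ℕ) : F) * μ ≤ v ((r + 1 + 1 : ℕ) : F) * μ ^ 2 := h
        _ = μ * (v ((r + 1 + 1 : ℕ) : F) * μ) := by rw [sq, mul_left_comm]
    have h1 : (1 : Γ₀) ≤ μ := le_of_mul_le_mul_right h' (mul_pos hp0' hμpos)
    exact absurd hμ1 (not_lt.mpr h1)
  · -- `v p * μ ≤ μ ^ p = μ ^ (p - 1) * μ` ⇒ `v p ≤ μ ^ (p-1) ≤ v q ^ (p - 1)`
    have h' : v ((r + 1 + 1 : ℕ) : F) * μ ≤ μ ^ (r + 1) * μ := by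
      calc v ((r + 1 + 1 : ℕ) : F) * μ ≤ μ ^ (r + 1 + 1) := h
        _ = μ ^ (r + 1) * μ := pow_succ μ (r + 1)
    have h1 : v ((r + 1 + 1 : ℕ) : F) ≤ μ ^ (r + 1) := le_of_mul_le_mul_right h' hμpos
    have h2 : μ ^ (r + 1) ≤ v q ^ (r + 1) := pow_le_pow_left' hμq (r + 1)
    have h3 : v q ^ (r + 1 + 1 - 1) < v ((r + 1 + 1 : ℕ) : F) := hpq
    rw [Nat.add_sub_cancel] at h3
    exact absurd (h1.trans h2) (not_le.mpr h3)

end Valuation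

/-! ## §2 An auxiliary modulus: for `n ≥ 3` an odd prime `ℓ ∣ n`, or `ℓ = 2` with `4 ∣ n` -/

/-- For `n ≥ 3` there is a prime `ℓ` and a modulus `q₀ ∣ n` with either `q₀ = ℓ ≥ 3` or `(q₀, ℓ) = (4, 2)`. -/
theorem exists_prime_modulus {n : ℕ} (hn : 3 ≤ n) :
    ∃ ℓ q₀ : ℕ, ℓ.Prime ∧ q₀ ∣ n ∧ ((q₀ = ℓ ∧ 3 ≤ ℓ) ∨ (q₀ = 4 ∧ ℓ = 2)) := by
  by_cases h4 : 4 ∣ n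
  · exact ⟨2, 4, Nat.prime_two, h4, Or.inr ⟨rfl, rfl⟩⟩
  · rcases Nat.even_or_odd n with ⟨k, hk⟩ | hodd
    · have hk1 : k ≠ 1 := by omega
      have hkodd : Odd k := by
        rcases Nat.even_or_odd k with ⟨j, hj⟩ | hko
        · exact absurd ⟨j, by omega⟩ h4
        · exact hko
      refine ⟨k.minFac, k.minFac, Nat.minFac_prime hk1, (Nat.minFac_dvd k).trans ⟨2, by omega⟩,
        Or.inl ⟨rfl, ?_⟩⟩
      have h2 := (Nat.minFac_prime hk1).two_le
      obtain ⟨t, ht⟩ := hkodd.of_dvd_nat (Nat.minFac_dvd k)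
      omega
    · have hn1 : n ≠ 1 := by omega
      refine ⟨n.minFac, n.minFac, Nat.minFac_prime hn1, Nat.minFac_dvd n, Or.inl ⟨rfl, ?_⟩⟩
      have h2 := (Nat.minFac_prime hn1).two_le
      obtain ⟨t, ht⟩ := hodd.of_dvd_nat (Nat.minFac_dvd n)
      omega

/-! ## §3 Finite places of `L` above a rational prime, and valuations of rational integers there -/

section Places

variable (L : CMField)

/-- Above every rational prime `ℓ` lies a finite place `v` of `L`, with `𝔭_v ∩ ℤ = (ℓ)`. -/
theorem exists_heightOneSpectrum_over_prime {ℓ : ℕ} (hℓ : ℓ.Prime) :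
    ∃ v : HeightOneSpectrum (𝓞 L), v.asIdeal.comap (algebraMap ℤ (𝓞 L)) = Ideal.span {(ℓ : ℤ)} := by
  have hp : Prime (ℓ : ℤ) := Nat.prime_iff_prime_int.mp hℓ
  haveI hmax : (Ideal.span {(ℓ : ℤ)}).IsMaximal :=
    ((Ideal.span_singleton_prime hp.ne_zero).mpr hp).isMaximal (by simpa using hp.ne_zero)
  have hker : RingHom.ker (algebraMap ℤ (𝓞 L)) ≤ Ideal.span {(ℓ : ℤ)} := by
    rw [(RingHom.injective_iff_ker_eq_bot _).mp (algebraMap ℤ (𝓞 L)).injective_int]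
    exact bot_le
  obtain ⟨Q, hQ, hQℓ⟩ :=
    Ideal.exists_ideal_over_maximal_of_isIntegral (S := 𝓞 L) (Ideal.span {(ℓ : ℤ)}) hker
  exact ⟨⟨Q, hQ.isPrime, Ring.ne_bot_of_isMaximal_of_not_isField hQ (RingOfIntegers.not_isField L)⟩, hQℓ⟩

variable {L}

/-- If `𝔭_v ∩ ℤ = (ℓ)`, a rational prime `p` lies in `𝔭_v` iff `p = ℓ`. -/
theorem natCast_mem_asIdeal_iff {ℓ : ℕ} (hℓ : ℓ.Prime) {v : HeightOneSpectrum (𝓞 L)}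
    (hv : v.asIdeal.comap (algebraMap ℤ (𝓞 L)) = Ideal.span {(ℓ : ℤ)}) {p : ℕ} (hp : p.Prime) :
    (p : 𝓞 L) ∈ v.asIdeal ↔ p = ℓ := by
  have key : (p : 𝓞 L) ∈ v.asIdeal ↔ (ℓ : ℤ) ∣ (p : ℤ) := by
    rw [← Ideal.mem_span_singleton, ← hv, Ideal.mem_comap, map_natCast]
  rw [key, Int.natCast_dvd_natCast]
  constructor
  · intro h
    exact ((Nat.prime_dvd_prime_iff_eq hℓ hp).mp h).symm
  · rintro rfl
    exact dvd_rfl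

/-- If `𝔭_v ∩ ℤ = (ℓ)` then `ℓ ∈ 𝔭_v`. -/
theorem natCast_mem_asIdeal {ℓ : ℕ} (hℓ : ℓ.Prime) {v : HeightOneSpectrum (𝓞 L)}
    (hv : v.asIdeal.comap (algebraMap ℤ (𝓞 L)) = Ideal.span {(ℓ : ℤ)}) : (ℓ : 𝓞 L) ∈ v.asIdeal :=
  (natCast_mem_asIdeal_iff hℓ hv hℓ).mpr rfl

/-- The `v`-adic valuation of a rational integer `k`, computed in `L_v`, is `v.intValuation k`. -/
theorem valued_natCast (v : HeightOneSpectrum (𝓞 L)) (k : ℕ) :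
    Valued.v ((k : ℕ) : v.adicCompletion L) = v.intValuation (k : 𝓞 L) := by
  have h1 : ((k : ℕ) : v.adicCompletion L) =
      algebraMap (L : Type) (v.adicCompletion L) (algebraMap (𝓞 L) L k) := by
    rw [map_natCast, map_natCast]
  rw [h1]
  exact (HeightOneSpectrum.valuedAdicCompletion_eq_valuation' v _).trans (v.valuation_of_algebraMap _)

/-- (Ported verbatim from the HodgeCMPerL package; no docstring in the source.) -/
theorem valued_natCast_le_one (v : HeightOneSpectrum (𝓞 L)) (k : ℕ) :
    Valued.v ((k : ℕ) : v.adicCompletion L) ≤ 1 := by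
  rw [valued_natCast]
  exact v.intValuation_le_one _

/-- (Ported verbatim from the HodgeCMPerL package; no docstring in the source.) -/
theorem valued_natCast_lt_one_iff (v : HeightOneSpectrum (𝓞 L)) (k : ℕ) :
    Valued.v ((k : ℕ) : v.adicCompletion L) < 1 ↔ (k : 𝓞 L) ∈ v.asIdeal := by
  rw [valued_natCast]
  exact v.intValuation_lt_one_iff_mem _

/-- (Ported verbatim from the HodgeCMPerL package; no docstring in the source.) -/
theorem valued_natCast_eq_one_iff (v : HeightOneSpectrum (𝓞 L)) (k : ℕ) :
    Valued.v ((k : ℕ) : v.adicCompletion L) = 1 ↔ (k : 𝓞 L) ∉ v.asIdeal := by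
  rw [valued_natCast]
  exact HeightOneSpectrum.intValuation_eq_one_iff

/-- (Ported verbatim from the HodgeCMPerL package; no docstring in the source.) -/
theorem valued_natCast_ne_zero (v : HeightOneSpectrum (𝓞 L)) {k : ℕ} (hk : k ≠ 0) :
    Valued.v ((k : ℕ) : v.adicCompletion L) ≠ 0 := by
  rw [valued_natCast]
  exact v.intValuation_ne_zero _ (Nat.cast_ne_zero.mpr hk)

variable (L) in
/-- **The place and modulus used for Minkowski–Serre.**  For `n ≥ 3` there are a finite place `v` of `L` and
`q₀ ∣ n` with `|q₀|_v < 1` and `|q₀|_v^(p-1) < |p|_v` for EVERY prime `p` (take `q₀ = ℓ` an odd prime factor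
of `n`, or `q₀ = 4` when `n` is a power of `2` times at most … — precisely when `4 ∣ n` — and `v ∣ ℓ`). -/
theorem exists_place_modulus {n : ℕ} (hn : 3 ≤ n) :
    ∃ (v : HeightOneSpectrum (𝓞 L)) (q₀ : ℕ), q₀ ∣ n ∧ Valued.v ((q₀ : ℕ) : v.adicCompletion L) < 1 ∧
      ∀ p : ℕ, p.Prime →
        Valued.v ((q₀ : ℕ) : v.adicCompletion L) ^ (p - 1) < Valued.v ((p : ℕ) : v.adicCompletion L) := by
  obtain ⟨ℓ, q₀, hℓ, hq₀n, hcase⟩ := exists_prime_modulus hn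
  obtain ⟨v, hv⟩ := exists_heightOneSpectrum_over_prime L hℓ
  have hℓv : (ℓ : 𝓞 L) ∈ v.asIdeal := natCast_mem_asIdeal hℓ hv
  have hℓ1 : Valued.v ((ℓ : ℕ) : v.adicCompletion L) < 1 := (valued_natCast_lt_one_iff v ℓ).mpr hℓv
  have hℓ0 : 0 < Valued.v ((ℓ : ℕ) : v.adicCompletion L) := zero_lt_iff.mpr (valued_natCast_ne_zero v hℓ.ne_zero)
  have hℓℓ : Valued.v ((ℓ : ℕ) : v.adicCompletion L) * Valued.v ((ℓ : ℕ) : v.adicCompletion L) <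
      Valued.v ((ℓ : ℕ) : v.adicCompletion L) := by
    simpa only [mul_one] using mul_lt_mul_of_pos_left hℓ1 hℓ0
  -- `|q₀|_v < 1` and, at `p = ℓ`, `|q₀|_v ^ (ℓ - 1) < |ℓ|_v`
  have hq₀ : Valued.v ((q₀ : ℕ) : v.adicCompletion L) < 1 ∧
      Valued.v ((q₀ : ℕ) : v.adicCompletion L) ^ (ℓ - 1) < Valued.v ((ℓ : ℕ) : v.adicCompletion L) := by
    rcases hcase with ⟨rfl, h3⟩ | ⟨rfl, rfl⟩
    · refine ⟨hℓ1, ?_⟩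
      calc Valued.v ((q₀ : ℕ) : v.adicCompletion L) ^ (q₀ - 1)
          ≤ Valued.v ((q₀ : ℕ) : v.adicCompletion L) ^ 2 := pow_le_pow_right_of_le_one' hℓ1.le (by omega)
        _ < Valued.v ((q₀ : ℕ) : v.adicCompletion L) := by rwa [sq]
    · have h4 : Valued.v ((4 : ℕ) : v.adicCompletion L) =
          Valued.v ((2 : ℕ) : v.adicCompletion L) * Valued.v ((2 : ℕ) : v.adicCompletion L) := by
        rw [← map_mul, ← Nat.cast_mul]
      refine ⟨?_, ?_⟩
      · rw [h4]
        exact hℓℓ.trans hℓ1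
      · rw [show (2 - 1 : ℕ) = 1 from rfl, pow_one, h4]
        exact hℓℓ
  refine ⟨v, q₀, hq₀n, hq₀.1, fun p hp => ?_⟩
  by_cases hpv : (p : 𝓞 L) ∈ v.asIdeal
  · obtain rfl : p = ℓ := (natCast_mem_asIdeal_iff hℓ hv hp).mp hpv
    exact hq₀.2
  · rw [(valued_natCast_eq_one_iff v p).mpr hpv]
    calc Valued.v ((q₀ : ℕ) : v.adicCompletion L) ^ (p - 1)
        ≤ Valued.v ((q₀ : ℕ) : v.adicCompletion L) ^ 1 :=
          pow_le_pow_right_of_le_one' hq₀.1.le (by have := hp.two_le; omega)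
      _ < 1 := by rw [pow_one]; exact hq₀.1

end Places

/-! ## §4 Evaluation at a place and the Minkowski–Serre lemma for `K(n) ≤ GL_m(𝔸_{L,f})` -/

section Global

variable (L : CMField) {m : ℕ}

local notation "𝔸f" => FiniteAdeleRing (𝓞 L) L

/-- Evaluation of a finite adele of `L` at the finite place `v`: `𝔸_{L,f} → L_v`. -/
def evalPlace (v : HeightOneSpectrum (𝓞 L)) : 𝔸f →+* v.adicCompletion L where
  toFun a := a v
  map_one' := rfl
  map_mul' _ _ := rfl
  map_zero' := rfl
  map_add' _ _ := rfl

/-- (Ported verbatim from the HodgeCMPerL package; no docstring in the source.) -/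
@[simp] theorem evalPlace_apply (v : HeightOneSpectrum (𝓞 L)) (a : 𝔸f) : evalPlace L v a = a v := rfl

/-- On principal adeles, evaluation at `v` is the embedding `L → L_v`. -/
theorem evalPlace_algebraMap (v : HeightOneSpectrum (𝓞 L)) (x : L) :
    evalPlace L v (algebraMap (L : Type) 𝔸f x) = (x : v.adicCompletion L) := rfl

/-- (Ported verbatim from the HodgeCMPerL package; no docstring in the source.) -/
theorem evalPlace_comp_algebraMap (v : HeightOneSpectrum (𝓞 L)) :
    (evalPlace L v).comp (algebraMap (L : Type) 𝔸f) = algebraMap (L : Type) (v.adicCompletion L) :=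
  RingHom.ext fun _ => rfl

variable {L} in
/-- Integral adeles have integral components: `|a_v|_v ≤ 1` for `a ∈ 𝒪̂_L`. -/
theorem valued_evalPlace_le_one (v : HeightOneSpectrum (𝓞 L)) {a : 𝔸f}
    (ha : a ∈ Literature.NumberTheory.Automorphic.integralFiniteAdeles L) :
    Valued.v (evalPlace L v a) ≤ 1 :=
  (HeightOneSpectrum.mem_adicCompletionIntegers (𝓞 L) L v).mp
    (Literature.NumberTheory.Automorphic.mem_integralFiniteAdeles_iff.mp ha v)

/-- `GL_m(𝔸_{L,f}) → GL_m(L_v)`, componentwise evaluation at `v`. -/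
def evalPlaceGL (v : HeightOneSpectrum (𝓞 L)) : GL (Fin m) 𝔸f →* GL (Fin m) (v.adicCompletion L) :=
  Units.map (evalPlace L v).mapMatrix.toMonoidHom

/-- (Ported verbatim from the HodgeCMPerL package; no docstring in the source.) -/
theorem val_evalPlaceGL (v : HeightOneSpectrum (𝓞 L)) (k : GL (Fin m) 𝔸f) :
    ((evalPlaceGL L v k : GL (Fin m) (v.adicCompletion L)) : Matrix (Fin m) (Fin m) (v.adicCompletion L)) =
      (k : Matrix (Fin m) (Fin m) 𝔸f).map (evalPlace L v) := rfl


-- port_pkg: scope closed for this part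
end Global
end HodgeCM.PerL34.Godement
end
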